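import Summits.RiemannHypothesis.RiemannHypothesis.Theses.SignCone
import Summits.RiemannHypothesis.RiemannHypothesis.Theorems.SignConeConeMagnificationCompactness
import Literature.NumberTheory.LFunctions.WeilExplicit
import Literature.NumberTheory.LFunctions.GeneralizedRH
import Summits.RiemannHypothesis.RiemannHypothesis.Theorems.SignConeConeMagnificationStubFakePNT
import Summits.RiemannHypothesis.RiemannHypothesis.Theorems.SignConeConeMagnificationStubChebyshev
import Summits.RiemannHypothesis.RiemannHypothesis.Theorems.SignConeConeMagnificationStubContinuation
import Summits.RiemannHypothesis.RiemannHypothesis.Theorems.SignConeConeMagnificationStubTransfer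
import Summits.RiemannHypothesis.RiemannHypothesis.Theorems.SignConeConeMagnificationStubDeficitOfTorus
import Summits.RiemannHypothesis.RiemannHypothesis.Theorems.SignConeConeMagnificationStubPdLaplace
import Summits.RiemannHypothesis.RiemannHypothesis.Theorems.SignConeConeMagnificationStubCara
import Summits.RiemannHypothesis.RiemannHypothesis.Theorems.SignConeConeMagnificationStubDeficitOfDesign
import Summits.RiemannHypothesis.RiemannHypothesis.Theorems.SignConeConeMagnificationStubCombZeroSide

/-!
# `SignCone.ConeMagnification` — line `Sketch` (landau-pinch architecture), skeleton r5
(item stmt-RiemannHypothesis-16303, route route-RiemannHypothesis-SignCone; crux dir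
`Cruxes/ConeMagnification/`; idea cards `Ideas/landau-pinch.md` (architecture),
`Ideas/forced-resonance-universality.md`, `Ideas/resonant-positive-witness.md`; line card `Lines/Sketch.md`)

CRUX: if at every cutoff `a > 0` some weight `c_a ≥ 0` on `ℕ` (`c_a 1 = 0`) has unit slack,
`-‖g‖₂² ≤ Re (W_ar(g ⋆ g̃) − P_{c_a}(g ⋆ g̃))` for all Weil tests `g` supported in `[-a, a]`, then RH.

REDUCTION ALREADY LANDED (`Theorems/SignConeConeMagnificationCompactness.lean`, p129201):
`coneMagnification_of_uniform` — it suffices to prove RH from ONE weight `c ≥ 0`, `c 1 = 0`, with unit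
slack against EVERY Weil test (slack-cone compactness, W-MAG Thm 1.2(ii) shape).  Below, "`US c`"
abbreviates that uniform unit-slack hypothesis, always written out verbatim (no local `def`).

THE LINE (r8: THIRTEEN stubs — NINE landed, FIVE open (`stub_fakeMertens`, `stub_combZeroSideC`, `stub_combLocal`, `stub_combType`,
`stub_designOfTypes` = the core) — composed sorry-free in
`ConeMagnification_of`, which since r5 first splits `by_cases RiemannHypothesis` (the RH branch is trivial:
the crux concludes RH), so the open stub carries `¬ RiemannHypothesis` as a usable hypothesis; r6 moved the open core to the
2001 design interface and r7 records that its two neighbours `stub_combZeroSide`, `stub_deficitOfDesign` landed in wave 1):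

* `stub_fakePNT` (LANDED p130740) — positive-definiteness of the unit-slack form on translate mixes ⇒ smoothed
  fake prime number theorem with `O(1)` error:
  `Σₙ c(n) n^{-1/2} (K(x + log n) + K(x − log n)) = e^{x/2} K̂(0) + e^{-x/2} K̂(1) + O_g(1)` uniformly in `x`.
* `stub_chebyshev` (LANDED p131015) — ⇒ `Σ c(n) n^{-σ} < ∞` for `σ > 1`.
* `stub_continuation` (LANDED p130893) — Laplace transform ⇒ thin-rectangle continuation of `L_c − 1/(s−1)`
  through every point of `re s > 1/2`.
* `stub_pdLaplace` (LANDED p132066) — `Re ∫₀^∞ ⟨D, K(·−y)⟩ e^{-zy} dy ≥ 0` (`Re z > 0`).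
* `stub_cara` (LANDED p133591, + aux p133402) — Carathéodory description (2001 swcm Thm A♭, necessity): ONE
  holomorphic `F = L_c − 1/(s−1)` on `re s > 1/2` with `Re F ≤ 1/2 + Re(1/s) + 𝒜(s) − ½log π`,
  `𝒜` = Poisson extension of `Re ψ(1/4+iv/2)` (`= ½ Re ψ(s/2)`).
* `stub_torusOfCara_offline` (OPEN CORE; r5 reshape of r4's `stub_torusOfCara`) — for a weight `c ≥ 0`,
  `c 1 = 0`, with UNIT SLACK against every Weil test, `Σ c n^{-σ} < ∞ (σ > 1)` and the Carathéodory majorant,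
  AND ASSUMING `¬RH`: the Riesz–Fejér torus inequality
  `Σ_{A⊆S} (c−Λ)(n_A) n_A^{-1/2} 2^{-|A|} cos(|A|φ) ≤ 1/2` for every finite prime set `S` and phase `φ`.
  WHY THIS SHAPE (lead c1 analysis, `Lines/Sketch.md` §r5):
  (a) under RH the crux needs nothing, so only the `¬RH` world matters; there, by the landed transfer
      (`stub_transfer` contraposed: `¬RH → hcont → hsum → ¬hdef`) and `stub_deficitOfTorus`, the torus conclusion
      is equivalent to `False` — the stub is exactly THM X "a uniform unit-slack weight cannot coexist with an
      off-line zero" (= W-MAG ∧ W-EFFMAG of the 2001 archive), no stronger and no weaker;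
  (b) the r4 statement also demanded the torus inequality IN THE RH WORLD for every infinite-support member of
      the cone — not needed by the crux and the one place a refutation could live (a member whose boundary
      measure `θ_{c−Λ}` has positive singular mass on zeta zeros: `T_{S,φ}(c−Λ) ≤ 1/2 + limsup_a mean(R_a θ_s⁺)`
      by the Herglotz representation, and nothing in the Cara data alone excludes `θ_s⁺ ≠ 0`); the two landed
      special cases (finite support p133361, ℓ¹(n^{-1/2}) modifications p133660) are exactly the ones with
      `θ_s⁺ = 0` for free;
  (c) the unit-slack form itself (Weil tests) is handed to the prover: every known passage to the deficit
      (2001 W-MAG §2–4: ζ-mollified resonator combs through `explicit_formula_holds`, the [CV]-type twisted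
      second moment, the design/type inequality eq:LO and absolute summability AX-A feeding the kernel-checked
      finite spine `reserve/prior-2001/…/Rh_WMagnificationY1_MagDeficit.lean`) works with tests, not with the
      majorant; `stub_fakePNT`/`stub_continuation`/`stub_pdLaplace` re-derive `hPNT`/`hcont`/`hPD` by name.
  DIFFICULTY FLOOR (Calibration p132538): applied to `c ≡ 𝟙_{n≥2}` the stub yields `Cara(𝟙) ∧ US(𝟙) → RH`, so
  any proof contains an Ω₊ theorem `Re ζ(s) > 3/2 + Re(1/s+1/(s−1)) + ½Re ψ(s/2) − ½log π` somewhere in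
  `re s > 1/2` (resonance-method strength relative to `½ log t`); inside the comb calculus this is the
  twisted-second-moment evaluation.  DEAD SHORTCUTS (do not retry): direct node-nonnegative two-bump
  witnesses (off-line gain `e^{(β₀−1/2)D}` < prime main term `e^{D/2}` for every support length `D`);
  positivity-dropped combs (the dropped off-diagonal `c`-terms cost `OffDiag_Λ ≍ κ'L·log M·B₀(0) ≫ ‖g‖²`);
  exactly-diagonal combs (bump width `1/(LM)` puts `ĝ` at heights `≤ LM` where a length-`M` mollifier does not
  mollify: the zero side regains `(log(LM)/2π)·‖g‖²`); Bohr means on a line `re s = σ` (lose `½ log T`).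
* `stub_deficitOfTorus` (LANDED p131512) — torus inequality ⇒ `Σ_p (log p − c(p))₊ /√p ≤ 2` (Fejér) ⇒
  summability of `Σ_p (log p − c(p))₊ p^{-σ}`, `σ > 1/2`.
* `stub_transfer` (LANDED p130783) — Landau transfer: continuation + deficit summability ⇒ RH.

`ConeMagnification_of` = `coneMagnification_of_uniform` ∘ (by_cases RH; transfer ∘ (chebyshev, continuation ∘
 fakePNT, deficitOfTorus ∘ torusOfCara_offline ∘ (cara ∘ pdLaplace, ¬RH))).
Literature vocabulary (`IsWeilTest`, `weilConv`, `weilReflect`, `weilMellin`, `weilPolarTerm`,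
`weilArchTerm`) is definitionally the item's Mathlib-primitive vocabulary (route CONE NOTE, `Iff.rfl`).
-/

noncomputable section

-- `Summit.RiemannHypothesis.RiemannHypothesis.…` repeats a namespace component by design (D-0017 layout).
set_option linter.dupNamespace false

open scoped BigOperators ComplexConjugate Topology
open Complex MeasureTheory Set Filter

namespace Summit.RiemannHypothesis.RiemannHypothesis.Cruxes.ConeMagnification.Sketch

open Literature.NumberTheory.LFunctions
open Summit.RiemannHypothesis.RiemannHypothesis.Theorems.SignCone
open Summit.RiemannHypothesis.RiemannHypothesis.Theorems.SignConeConeMagnification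

/-! ### The registered stubs (signatures over existing declarations only) -/

/-! Stubs `stub_fakePNT` (p130740), `stub_chebyshev` (p131015), `stub_pdLaplace` (p132066), `stub_cara`
(p133591), `stub_deficitOfTorus` (p131512) are LANDED in namespace `…Theorems.SignConeConeMagnification`;
`stub_continuation` (p130893) and `stub_transfer` (p130783) in this file's namespace
`…Cruxes.ConeMagnification.Sketch` (all imported above).  Reshape history: r2 split the monolithic
`stub_deficit` (W-MAG Thm 1.2(i)) into `stub_torusIneq` + the finite Fejér spine `stub_deficitOfTorus`; r3 split
`stub_torusIneq` into `stub_pdLaplace` → `stub_cara` → `stub_torusOfCara`; r5 (lead c1) replaces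
`stub_torusOfCara` by `stub_torusOfCara_offline` (same conclusion; hypotheses `¬RH` and unit slack added; the
composition now splits `by_cases RiemannHypothesis`). -/

/-! #### r6 (lead c1, same cycle): the open core is restated in the 2001 DESIGN-INEQUALITY interface and split
three ways.  Why: every known passage to the prime deficit is a resonator-comb calculus whose OUTPUT is not the
pollution-free torus inequality at `σ = 1/2` but (i) absolute summability `Σ |c−Λ|(n)/n < ∞` (AX-A), (ii) a composite-mass
bound (AX-B) and (iii) the design/type inequality eq:LO `Σ_n ((c−Λ)(n)/n)·Φ_{S,a,φ}(n) ≤ M/2` for Riesz–Euler profiles `Φ`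
(which see every `n = n_A·k`, `k` coprime to `S`: "pollution") (AX-C) — and the passage from (i)–(iii) to the deficit is the
finite spine of W-MAG §5, kernel-checked in the prior programme's stockroom
(`reserve/prior-2001/Prior/RiemannHypothesis/RiemannHypothesis/Rh_WMagnificationY1_MagDeficit.lean`, `deficit_summable`,
GREEN over exactly this interface).  So: `stub_combZeroSide` (c-free, unconditional, provable now: ζ-mollified combs are
Weil-neutral), `stub_designOfOffline` (THE OPEN CORE: ¬RH + unit slack + Cara data + comb zero side ⇒ AX-A ∧ AX-B ∧ AX-C
at `M = 1`; under its hypotheses ≡ `False` ≡ THM X, exactly as in r5), `stub_deficitOfDesign` (the spine: AX-A → AX-B → AX-C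
→ deficit summability for `σ > 1/2`; adapt the stockroom file).  `stub_deficitOfTorus` (p131512) stays landed, now unused. -/

/-! **Stub Z — `stub_combZeroSide` is LANDED** (wave 1, p140318, `Theorems/SignConeConeMagnificationStubCombZeroSide.lean`,
namespace `…Theorems.SignConeConeMagnification`; c-free and unconditional: ζ-mollified resonator combs
`g(u) = Σ_{m≤LM} (α⋆β_M)_m b₁((u−log m)M/κ)`, `κ = (log M)^θ`, satisfy `|Re(W_ar(K) − P_Λ(K))| ≤ ε‖g‖₂²` for `M ≥ M₀(α,L,b₁,θ,ε)`;
supporting Literature landed with it: `ZetaTruncationUniform` p137124 (Titchmarsh (4.11.1)), `ZeroSumSobolev` p137320,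
`DirichletPolynomialStripMeanValue` p137526, `ZetaPartialSumAtZeros` p137650, `ZetaPartialSumZeroBlocks` p138247,
`ZetaPartialSumLowZeros` p138399, `ZetaPartialSumZeroTotal` p138728, `WeilLogLatticeComb` p137910, `DivisorCombFactorisation` p138006,
`WeilCombZeroSide` p139141, `WeilLogLatticeCombNorm` p139373, `MollifiedCoefficientsMeanSquare` p139699, `WeilCombNormLowerBound` p140031). -/


/-! #### r8 (lead c1): the comb EVALUATION is no longer an unlocated gap.
Organising the node sum BY NODE (Poisson summation along each progression `ℓk`, then the free sum over `k'` for fixed `n`)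
shows that the off-diagonal mass of the mollified comb splits into a SMOOTH part (the `j = 0` Poisson mode; its
`c`-versus-`Λ` discrepancy is `O((κ/M)²·LM)`, i.e. `O(κL/log M)·‖g‖²`, from Mertens-level information
`Σ_{n≤x}(c−Λ)(n)/n = O(1)` alone) and an ARITHMETIC part which after the `k'`-sum depends on `n` only through
`gcd(nℓ',ℓ)` and `log n` — reproducing the [CV] gcd form `Φ_α(n) = Σ_{ℓ,ℓ'} α_ℓ ᾱ_ℓ' gcd(nℓ',ℓ)/√(ℓℓ')` times `log(M/κn)`
plus a bounded secondary gcd-profile, with all errors `O(κ/log M)·‖g‖²` (validated numerically: compute/combcheck.py,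
per-node agreement 10⁻³–10⁻⁴ in the comb regime).  No statement about `c` in short windows or in invertible residue
classes is needed.  Hence the split below: `stub_fakeMertens` (Mertens-level input from the fake PNT), `stub_combZeroSideC`
(complex-coefficient zero side), `stub_combLocal` (comb evaluation + 2-point designs `δ₁ + tδ_p`, `t` of both signs ⇒
`Σ_{p∣n} c(n)/n < ∞` for every prime `p`), `stub_combType` (the TYPE INEQUALITY `Σ_n ((c−Λ)(n)/n)·Re Φ_α(n) ≤ ½Φ_α(1)` for every
finitely supported complex design), `stub_designOfTypes` (OPEN CORE: type inequalities + everything else ⇒ AX-A ∧ AX-B ∧ AX-C;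
the 2001 §3–5 design algebra — Riesz–Euler products over the DEFICIT primes only, rotation `e^{iφ}` and Fejér `|b₁| ≤ 2b₀`,
pollution control; whether the type inequalities alone suffice is not settled — unit slack and the Carathéodory data stay
available as hypotheses). -/

/-- **Stub M — `fakeMertens` (PROVABLE NOW).**  For `c ≥ 0` with the fake PNT bound of `stub_fakePNT` (for every Weil test
`g`, uniformly in `x`: `Σ c(n)n^{-1/2}(K(x+log n)+K(x−log n)) = e^{x/2}K̂(0) + e^{-x/2}K̂(1) + O_g(1)`, `K = g⋆g̃`):
(i) Chebyshev `Σ_{n≤x} c(n) ≤ A·x` (`x ≥ 1`); (ii) Mertens `Σ_{n≤x} c(n)/n − log x → C`.  Sketch: with a nonnegative narrow bump `g`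
(`exists_nodeNonneg_bump`), `K ≥ 0` has compact support and `Σ_n c(n) K₂(log(X/n)) = X·K̂(0) + O(√X)` for `K₂(v) = K(v)e^{v/2}`
(square-root smooth-window PNT); a dyadic smooth partition of unity gives (i), and (ii) follows by Abel summation, the sharp edge at
`x` costing `O(η) + O_η(x^{-1/2})` for every `η` by monotonicity (`c ≥ 0`). [folklore] -/
theorem stub_fakeMertens :
    ∀ c : ℕ → ℝ, (∀ n, 0 ≤ c n) →
      (∀ g : ℝ → ℂ, IsWeilTest g → ∃ C : ℝ, ∀ x : ℝ,
        ‖(∑' n : ℕ, ((c n : ℝ) : ℂ) / (Real.sqrt n : ℂ) *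
            (weilConv g (weilReflect g) (x + Real.log n) + weilConv g (weilReflect g) (x - Real.log n))) -
          Complex.exp (x / 2) * weilMellin (weilConv g (weilReflect g)) 0 -
          Complex.exp (-(x / 2)) * weilMellin (weilConv g (weilReflect g)) 1‖ ≤ C) →
      ((∃ A : ℝ, ∀ x : ℝ, 1 ≤ x → ∑ n ∈ Finset.Icc 1 ⌊x⌋₊, c n ≤ A * x) ∧
        (∃ C : ℝ, Filter.Tendsto (fun x : ℝ => (∑ n ∈ Finset.Icc 1 ⌊x⌋₊, c n / n) - Real.log x)
          Filter.atTop (nhds C))) := by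
  sorry

/-- **Stub Zc — `combZeroSideC` (PROVABLE NOW; complex-coefficient version of the landed `stub_combZeroSide` p140318).**
Same statement with a complex finitely supported resonator `α : ℕ → ℂ` (needed for rotated Riesz–Euler designs
`α_{n_A} = Π_{p∈A} θ_p e^{i|A|φ}`); the landed proof goes through verbatim (the zero sum is bounded absolutely:
`Σ_ρ m_ρ |ĝ(ρ)||ĝ(1−ρ̄)|`, `ĝ = b̂·Ã·ζ_M(1−s)`, `|Ã| ≤ ‖α‖₁`). [folklore] -/
theorem stub_combZeroSideC :
    ∀ α : ℕ → ℂ, ∀ L : ℕ, (∀ m, L < m → α m = 0) →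
      ∀ b₁ : ℝ → ℂ, IsWeilTest b₁ → tsupport b₁ ⊆ Set.Icc (-1) 1 →
      ∀ θ : ℝ, 0 < θ → θ < 1 → ∀ ε : ℝ, 0 < ε → ∃ M₀ : ℕ, ∀ M : ℕ, M₀ ≤ M →
        let κ : ℝ := Real.log M ^ θ
        let g : ℝ → ℂ := fun u => ∑ m ∈ Finset.range (L * M + 1),
          (∑ k ∈ (Nat.divisors m).filter (· ≤ M), α (m / k) / (Real.sqrt k : ℂ)) *
            b₁ ((u - Real.log m) * (M : ℝ) / κ)
        |(weilPolarTerm (weilConv g (weilReflect g)) + weilArchTerm (weilConv g (weilReflect g)) -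
            ∑' n : ℕ, ((ArithmeticFunction.vonMangoldt n : ℝ) : ℂ) / (Real.sqrt n : ℂ) *
              (weilConv g (weilReflect g) (Real.log n) + weilConv g (weilReflect g) (-Real.log n))).re| ≤
          ε * ∫ u, ‖g u‖ ^ 2 := by
  sorry

/-- **Stub E — `combLocal` (the comb EVALUATION + local designs; TRUE for every unit-slack weight by the r8 analysis).**
For `c ≥ 0`, `c 1 = 0`, with unit slack against every Weil test, Chebyshev and Mertens (outputs of `stub_fakeMertens`):
for every prime `p`, `Σ_{n : p ∣ n} c(n)/n < ∞`.
PROOF ROUTE (lead c1 analysis, `Lines/Sketch.md` §r8): (1) unit slack at the mollified comb `g` of the landed `stub_combZeroSide`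
(real 2-point design `α = δ₁ + t·δ_p`, `κ = (log M)^{1/2}`) minus `explicit_formula_holds` and the zero-side bound give
`Σ_n (c−Λ)(n) n^{-1/2}·2K(log n) ≤ (1+ε)‖g‖₂²`.  (2) NODE-WEIGHT EVALUATION: `n^{-1/2}·2K(log n) = w_smooth(n) + w_arith(n) + err(n)`,
`w_smooth(n) = 2(κ/M)²|b̂₁(0)|² Re Σ_{ℓ,ℓ'} α_ℓ ᾱ_ℓ' √(ℓ'/ℓ)·#{k' ≤ M : nℓ'k' ≤ ℓM}`,
`w_arith(n) = (2κ/(Mn)) Re Σ_{ℓ,ℓ'} α_ℓ ᾱ_ℓ' (g/√(ℓℓ'))·[B₁(0)·log(g²M/(κ n ℓ ℓ')) + C_H]` on `g²M ≥ κnℓℓ'` (`g = gcd(nℓ',ℓ)`,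
`B₁ = b₁⋆b̃₁`, `C_H = B₁(0)(γ − log 2) − |b̂₁(0)|²/2 + ∫_{1/2}^∞ Σ_{j≠0}|b̂₁(2πjv)|² dv`), from Poisson summation along each
progression `ℓk` (`Σ_k B_M(log(y/ℓk)) = (y/ℓ)(κ/M)² Σ_j e(−jy/ℓ)|b̂₁(2πjκy/(ℓM))|²`) and the free `k'`-sum for FIXED `n`
(the residues `nℓ'k' mod ℓ` equidistribute over `gcd(nℓ',ℓ)ℤ/ℓℤ`); `Σ_n (c+Λ)(n)|err(n)| = O_{α,b₁}(κ²/M) = O(κ/log M)‖g‖₂²`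
using only Chebyshev.  (3) `|Σ_n (c−Λ)(n) w_smooth(n)| = O((κ/M)²·LM·sup_x|Σ_{n≤x}(c−Λ)(n)/n|) = o(‖g‖₂²)` by Abel summation
(Mertens).  (4) Hence `2Σ_n ((c−Λ)(n)/n)Φ_α(n)(1 − log(κn)/log M)₊ + O(1/log M)·Σ_{n≤M/κ}((c−Λ)(n)/n)Ψ_α(n) ≤ (1+ε)Φ_α(1) + o(1)`
with `Φ_α(n) = 1 + t² + (t/√p)(1 + gcd(n,p))`; since `Σ_{n≤x}(c−Λ)(n)/n` converges, a divergent `Σ_{p∣n} c(n)/n` makes the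
left side `→ +∞` for `t > 0` — contradiction; boundedness + monotonicity (`c ≥ 0`) give summability. [folklore] -/
theorem stub_combLocal :
    ∀ c : ℕ → ℝ, (∀ n, 0 ≤ c n) → c 1 = 0 →
      (∀ g : ℝ → ℂ, IsWeilTest g →
        -(∫ t, ‖g t‖ ^ 2) ≤
          (weilPolarTerm (weilConv g (weilReflect g)) + weilArchTerm (weilConv g (weilReflect g)) -
            ∑' n : ℕ, ((c n : ℝ) : ℂ) / (Real.sqrt n : ℂ) *
              (weilConv g (weilReflect g) (Real.log n) + weilConv g (weilReflect g) (-Real.log n))).re) →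
      ((∃ A : ℝ, ∀ x : ℝ, 1 ≤ x → ∑ n ∈ Finset.Icc 1 ⌊x⌋₊, c n ≤ A * x) ∧
        (∃ C : ℝ, Filter.Tendsto (fun x : ℝ => (∑ n ∈ Finset.Icc 1 ⌊x⌋₊, c n / n) - Real.log x)
          Filter.atTop (nhds C))) →
      (∀ p : ℕ, p.Prime → Summable (fun n : ℕ => if p ∣ n then c n / n else 0)) := by
  sorry

/-- **Stub T — `combType` (the [CV] TYPE INEQUALITY for every finitely supported complex design; TRUE for unit-slack weights
by the r8 analysis).**  For `c` as in `stub_combLocal` plus its conclusion (so that every gcd-class sum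
`Σ_{gcd(n,Q)=δ} (c−Λ)(n)/n` converges): for every `α : ℕ → ℂ` supported in `[1, L]`, with the gcd form
`Φ_α(n) = Σ_{ℓ,ℓ'≤L} α_ℓ conj(α_ℓ') gcd(nℓ',ℓ)/√(ℓℓ')`, the partial sums `Σ_{n≤x} ((c−Λ)(n)/n)·Re Φ_α(n)` converge (conditionally —
`Summable` would already be AX-A) to a limit `T ≤ ½·Φ_α(1)` (`Φ_α(1)` is real and `≥ 0`: `gcd(ℓ',ℓ) = Σ_{d∣ℓ,d∣ℓ'} φ(d)`).  The complex comb zero-side lemma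
(`stub_combZeroSideC`, verbatim) is handed in as a hypothesis.  Route: steps (1)–(3) of `stub_combLocal` for complex
`α` (zero side: `stub_combZeroSideC`), the same finite-`M` inequality, and `M → ∞` (logarithmic Riesz means of a convergent series).
Consistency checks: `α = δ₁`: `C₁ := Σ (c−Λ)(n)/n ≤ 1/2` (2001 trivial design); `α = δ₁ + sδ_p`, optimised `s`:
`|Σ_{p∣n}(c−Λ)(n)/n| ≤ 2(½ − C₁)/(√p − 1)`, i.e. `|c(p) − log p| ≤ √p·(1+o(1))` for a single-prime modification — the disprover's
predicted prime-variation constant 1 (`slackCone_prime_variation_le_one`), consistent with SlackBall (`|m| ≤ √p/2`) and the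
deficit-1/2 tightness. [folklore] -/
theorem stub_combType :
    ∀ c : ℕ → ℝ, (∀ n, 0 ≤ c n) → c 1 = 0 →
      (∀ g : ℝ → ℂ, IsWeilTest g →
        -(∫ t, ‖g t‖ ^ 2) ≤
          (weilPolarTerm (weilConv g (weilReflect g)) + weilArchTerm (weilConv g (weilReflect g)) -
            ∑' n : ℕ, ((c n : ℝ) : ℂ) / (Real.sqrt n : ℂ) *
              (weilConv g (weilReflect g) (Real.log n) + weilConv g (weilReflect g) (-Real.log n))).re) →
      ((∃ A : ℝ, ∀ x : ℝ, 1 ≤ x → ∑ n ∈ Finset.Icc 1 ⌊x⌋₊, c n ≤ A * x) ∧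
        (∃ C : ℝ, Filter.Tendsto (fun x : ℝ => (∑ n ∈ Finset.Icc 1 ⌊x⌋₊, c n / n) - Real.log x)
          Filter.atTop (nhds C))) →
      (∀ p : ℕ, p.Prime → Summable (fun n : ℕ => if p ∣ n then c n / n else 0)) →
      (∀ α : ℕ → ℂ, ∀ L : ℕ, (∀ m, L < m → α m = 0) →
      ∀ b₁ : ℝ → ℂ, IsWeilTest b₁ → tsupport b₁ ⊆ Set.Icc (-1) 1 →
      ∀ θ : ℝ, 0 < θ → θ < 1 → ∀ ε : ℝ, 0 < ε → ∃ M₀ : ℕ, ∀ M : ℕ, M₀ ≤ M →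
        let κ : ℝ := Real.log M ^ θ
        let g : ℝ → ℂ := fun u => ∑ m ∈ Finset.range (L * M + 1),
          (∑ k ∈ (Nat.divisors m).filter (· ≤ M), α (m / k) / (Real.sqrt k : ℂ)) *
            b₁ ((u - Real.log m) * (M : ℝ) / κ)
        |(weilPolarTerm (weilConv g (weilReflect g)) + weilArchTerm (weilConv g (weilReflect g)) -
            ∑' n : ℕ, ((ArithmeticFunction.vonMangoldt n : ℝ) : ℂ) / (Real.sqrt n : ℂ) *
              (weilConv g (weilReflect g) (Real.log n) + weilConv g (weilReflect g) (-Real.log n))).re| ≤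
          ε * ∫ u, ‖g u‖ ^ 2) →
      (∀ α : ℕ → ℂ, ∀ L : ℕ, (∀ m, L < m → α m = 0) →
        ∃ T : ℝ, Filter.Tendsto (fun x : ℝ => ∑ n ∈ Finset.Icc 1 ⌊x⌋₊,
            (c n - ArithmeticFunction.vonMangoldt n) / n *
              (∑ ℓ ∈ Finset.Icc 1 L, ∑ ℓ' ∈ Finset.Icc 1 L, α ℓ * (starRingEnd ℂ) (α ℓ') *
              (((Nat.gcd (n * ℓ') ℓ : ℕ) : ℝ) : ℂ) / (Real.sqrt ((ℓ : ℝ) * ℓ') : ℂ)).re) Filter.atTop (nhds T) ∧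
          T ≤ 1 / 2 * (∑ ℓ ∈ Finset.Icc 1 L, ∑ ℓ' ∈ Finset.Icc 1 L, α ℓ * (starRingEnd ℂ) (α ℓ') *
              (((Nat.gcd (1 * ℓ') ℓ : ℕ) : ℝ) : ℂ) / (Real.sqrt ((ℓ : ℝ) * ℓ') : ℂ)).re) := by
  sorry

/-- **Stub 4c — `designOfTypes` (THE OPEN CORE since r8; 2001 W-MAG §3–5 "design algebra" = THM X given the comb outputs).**
Assume RH FAILS.  For `c ≥ 0`, `c 1 = 0`, with unit slack, `Σ c n^{-σ} < ∞ (σ>1)`, the Carathéodory majorant, Chebyshev+Mertens,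
local summability `Σ_{p∣n} c(n)/n < ∞` (all `p`) and the TYPE INEQUALITIES `Σ_n ((c−Λ)(n)/n) Re Φ_α(n) ≤ ½Φ_α(1)` for every finitely
supported complex design `α`: the 2001 design data (AX-A) `Σ|c−Λ|(n)/n < ∞`, (AX-B) composite mass `Σ (c(n)/n)e₂(n) < ∞`,
(AX-C) the Riesz–Euler design inequality with constant `1/2` (the socket of the landed spine `stub_deficitOfDesign`).
WHAT IS KNOWN (lead c1): product designs `α = ⊗_{p∈S}(1, s_p√p·δ_p)` give multiplicative profiles `Π_{p∈S, p∣n} r_p`,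
`r_p ∈ [−(√p+1)/2, (√p−1)/2]·(1+o(1))` (the 2001 admissible interval `I_p`); rotating `r_p = τ_p e^{iφ}` makes
`φ ↦ ½Φ(1) − Σ(d/n)ReΦ_{α_φ}(n)` a nonnegative cosine polynomial `b₀ − Σ_k b_k cos(kφ)` with `b_k = Σ_{|A|=k} τ_A M_A`
(`M_A` = class sum over `n` with `S`-part `A`), so Fejér gives `|b₁| ≤ 2b₀` and `Σ_{k≥2} b_k ≤ 3(½ − C₁)` (φ = 0), i.e. bounded
`τ`-weighted squarefree composite mass and hence pollution `Σ_p τ_p Q_p(z) ≤ 3(½−C₁)/τ_{z+1} → 0`; with `S` = the DEFICIT primes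
`≤ z` (weights `a_p`), the surplus primes sit outside `S` inside the convergent `C₁`.  NOT SETTLED: `b₀ = ½ − Σ_{(n,P_S)=1} d(n)/n`
contains the unweighted class masses, and AX-B's `e₂`-weights versus Fejér's per-harmonic bounds (`k²5^k` blow-up) — the
designs that close AX-A/AX-B may need unit slack beyond the `κ = (log M)^θ` comb family (e.g. high-height tests: the
"prime shuffle" `c(p_{2i})=0, c(p_{2i+1}) = log p_{2i} + log p_{2i+1}` dies only by `Re L_d(½+it) ≍ t`).  Hence unit slack
and the Carathéodory data remain hypotheses; under `¬RH` the conclusion is again equivalent to `False`. [folklore] -/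
theorem stub_designOfTypes :
    ¬ RiemannHypothesis →
    ∀ c : ℕ → ℝ, (∀ n, 0 ≤ c n) → c 1 = 0 →
      (∀ g : ℝ → ℂ, IsWeilTest g →
        -(∫ t, ‖g t‖ ^ 2) ≤
          (weilPolarTerm (weilConv g (weilReflect g)) + weilArchTerm (weilConv g (weilReflect g)) -
            ∑' n : ℕ, ((c n : ℝ) : ℂ) / (Real.sqrt n : ℂ) *
              (weilConv g (weilReflect g) (Real.log n) + weilConv g (weilReflect g) (-Real.log n))).re) →
      (∀ σ : ℝ, 1 < σ → LSeriesSummable (fun n => ((c n : ℝ) : ℂ)) σ) →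
      (∃ F : ℂ → ℂ, DifferentiableOn ℂ F {s : ℂ | 1 / 2 < s.re} ∧
        (∀ s : ℂ, 1 < s.re → F s = LSeries (fun n => ((c n : ℝ) : ℂ)) s - 1 / (s - 1)) ∧
        ∀ s : ℂ, 1 / 2 < s.re →
          (F s).re ≤ 1 / 2 + (1 / s).re +
            1 / (2 * Real.pi) * (∫ v : ℝ, (Complex.digamma (1 / 4 + v / 2 * Complex.I)).re *
              ((s.re - 1 / 2) / ((s.re - 1 / 2) ^ 2 + (s.im - v) ^ 2))) - Real.log Real.pi / 2) →
      ((∃ A : ℝ, ∀ x : ℝ, 1 ≤ x → ∑ n ∈ Finset.Icc 1 ⌊x⌋₊, c n ≤ A * x) ∧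
        (∃ C : ℝ, Filter.Tendsto (fun x : ℝ => (∑ n ∈ Finset.Icc 1 ⌊x⌋₊, c n / n) - Real.log x)
          Filter.atTop (nhds C))) →
      (∀ p : ℕ, p.Prime → Summable (fun n : ℕ => if p ∣ n then c n / n else 0)) →
      (∀ α : ℕ → ℂ, ∀ L : ℕ, (∀ m, L < m → α m = 0) →
        ∃ T : ℝ, Filter.Tendsto (fun x : ℝ => ∑ n ∈ Finset.Icc 1 ⌊x⌋₊,
            (c n - ArithmeticFunction.vonMangoldt n) / n *
              (∑ ℓ ∈ Finset.Icc 1 L, ∑ ℓ' ∈ Finset.Icc 1 L, α ℓ * (starRingEnd ℂ) (α ℓ') *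
              (((Nat.gcd (n * ℓ') ℓ : ℕ) : ℝ) : ℂ) / (Real.sqrt ((ℓ : ℝ) * ℓ') : ℂ)).re) Filter.atTop (nhds T) ∧
          T ≤ 1 / 2 * (∑ ℓ ∈ Finset.Icc 1 L, ∑ ℓ' ∈ Finset.Icc 1 L, α ℓ * (starRingEnd ℂ) (α ℓ') *
              (((Nat.gcd (1 * ℓ') ℓ : ℕ) : ℝ) : ℂ) / (Real.sqrt ((ℓ : ℝ) * ℓ') : ℂ)).re) →
      Summable (fun n : ℕ => |c n - ArithmeticFunction.vonMangoldt n| / (n : ℝ)) ∧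
      Summable (fun n : ℕ => if 2 ≤ n ∧ ¬ IsPrimePow n then
        c n / (n : ℝ) * (∑ q ∈ n.primeFactors, ∑ q' ∈ n.primeFactors.filter (fun q' => q < q'),
          ((Real.sqrt q - 1) / 2) * ((Real.sqrt q' - 1) / 2)) else 0) ∧
      (∀ S : Finset ℕ, (∀ p ∈ S, p.Prime) → ∀ a : ℕ → ℝ, (∀ p ∈ S, 0 ≤ a p ∧ a p ≤ 1) → ∀ φ : ℝ,
        (∑' n : ℕ, (c n - ArithmeticFunction.vonMangoldt n) / (n : ℝ) *
          (if ∀ p ∈ S, ¬ (p ^ 2 ∣ n) then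
            Real.sqrt (∏ p ∈ S.filter (· ∣ n), (p : ℝ)) * (∏ p ∈ S.filter (· ∣ n), a p) *
              (1 / 2) ^ (S.filter (· ∣ n)).card * Real.cos (((S.filter (· ∣ n)).card : ℝ) * φ)
          else 0)) ≤ 1 / 2) := by
  sorry

/-! **Stub 4d — `stub_deficitOfDesign` is LANDED** (wave 1, p137772, `Theorems/SignConeConeMagnificationStubDeficitOfDesign.lean`,
namespace `…Theorems.SignConeConeMagnification`; the finite spine of W-MAG §5 adapted from the stockroom `MagDeficit` file:
AX-A → AX-B → AX-C(1/2) → `∀ σ > 1/2, Summable deficit·p^{-σ}`; with `…DesignDefs` p137034 (vocabulary, namespace `….Design`),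
`…DesignSpineA` p137424, `…DesignSpineB` p137583). -/


/-! ### The composition (sorry-free glue; concludes the crux BY NAME) -/

/-- **`SignCone.ConeMagnification` from the stubs.**  By slack-cone compactness
(`coneMagnification_of_uniform`, landed) it suffices to treat ONE weight `c ≥ 0`, `c 1 = 0`, with unit
slack against every Weil test; if RH holds there is nothing to do; otherwise `stub_fakePNT` and
`stub_continuation` continue `L_c − 1/(s−1)`, `stub_pdLaplace` → `stub_cara` give the Carathéodory majorant,
`stub_designOfOffline` (fed `¬RH`, the unit slack and the c-free comb zero-side lemma `stub_combZeroSide`) gives the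
2001 design data, `stub_deficitOfDesign` (finite spine) bounds the prime deficit, and `stub_transfer` (Landau)
concludes RH (`stub_chebyshev` supplies absolute convergence of `L_c` on `re s > 1`). [folklore] -/
theorem ConeMagnification_of :
    Summit.RiemannHypothesis.RiemannHypothesis.Theses.SignCone.ConeMagnification := by
  refine coneMagnification_of_uniform ?_
  rintro ⟨c, hc0, hc1, hU⟩
  by_cases hRH : RiemannHypothesis
  · exact hRH
  have hPNT := stub_fakePNT c hc0 hU
  have hsum := stub_chebyshev c hc0 hPNT
  have hcont := stub_continuation c hc0 hPNT hsum
  have hPD := stub_pdLaplace c hc0 hU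
  have hF := stub_cara c hc0 hc1 hU hsum hcont hPD
  have hM := stub_fakeMertens c hc0 hPNT
  have hLoc := stub_combLocal c hc0 hc1 hU hM
  have hZc := stub_combZeroSideC
  have hTI := stub_combType c hc0 hc1 hU hM hLoc hZc
  obtain ⟨hA, hB, hC⟩ := stub_designOfTypes hRH c hc0 hc1 hU hsum hF hM hLoc hTI
  have hdef := stub_deficitOfDesign c hc0 hc1 hA hB hC
  exact stub_transfer c hc0 hsum hcont hdef

end Summit.RiemannHypothesis.RiemannHypothesis.Cruxes.ConeMagnification.Sketch

end
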